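import Summits.AtomisticToContinuum.HydrodynamicLimit.Theorems.OneSphereInfluenceHardCorePoincareDobrushinInvariance

/-!
# OneSphereInfluenceHardCorePoincareDobrushinSpectral — Abstract Dobrushin theory III: the spectral
step and the bounded Poincaré inequality

This file is part 6/9 of the DobrushinDoor chain proving the crux
`OneSphereInfluence.HardCorePoincare` (stmt-AtomisticToContinuum-13619) sorry-free; the closing
theorem `hardCorePoincare_holds` and the full account are in
`OneSphereInfluenceHardCorePoincareDobrushin.lean` (part 9/9). decomp-a2c · lens-1 · g39.

CONTENTS. Model-free. Iterates of the random-scan operator, log-convexity of `k ↦ ‖T^k g‖²`, and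
`variance_le_of_dobrushin_bounded : ∫ (f − μ f)² ≤ (1 − D)⁻¹ Σ_i ∫ (f − P_i f)²` for bounded
measurable `f` under locality, invariance and Dobrushin`s row-sum condition.
-/

open MeasureTheory ProbabilityTheory Set Function
open scoped ENNReal

noncomputable section

namespace Summit.AtomisticToContinuum.HydrodynamicLimit.Theorems.HardCorePoincareDobrushin.Abstract

variable {n : ℕ} {E : Type} [MeasurableSpace E]
variable {K : Fin (n + 1) → Kernel (Fin (n + 1) → E) E} [∀ i, IsMarkovKernel (K i)]

/-! ### The spectral step and the bounded Dobrushin–Glauber Poincaré inequality -/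

section Spectral

variable {μ : Measure (Fin (n + 1) → E)} [IsProbabilityMeasure μ]

/-- Iterates of the scan operator preserve measurability. -/
theorem measurable_iterate_scanOp {f : (Fin (n + 1) → E) → ℝ} (hf : Measurable f) (k : ℕ) :
    Measurable ((scanOp K)^[k] f) := by
  induction k with
  | zero => exact hf
  | succ k ih =>
      rw [Function.iterate_succ_apply']
      exact measurable_scanOp K ih

/-- Iterates of the scan operator preserve the uniform bound `|f| ≤ M`. -/
theorem abs_iterate_scanOp_le {f : (Fin (n + 1) → E) → ℝ} {M : ℝ} (hfM : ∀ z, |f z| ≤ M)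
    (k : ℕ) : ∀ z, |((scanOp K)^[k] f) z| ≤ M := by
  induction k with
  | zero => exact hfM
  | succ k ih =>
      intro z
      rw [Function.iterate_succ_apply']
      exact abs_scanOp_le K ih z

/-- Under the invariance identity, iterates of the scan operator preserve the `μ`-integral. -/
theorem integral_iterate_scanOp
    (hinv : ∀ i (F : (Fin (n + 1) → E) → ℝ≥0∞), Measurable F →
      ∫⁻ z, ∫⁻ y, F (update z i y) ∂(K i z) ∂μ = ∫⁻ z, F z ∂μ)
    {f : (Fin (n + 1) → E) → ℝ} (hf : Measurable f) {M : ℝ} (hfM : ∀ z, |f z| ≤ M) (k : ℕ) :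
    ∫ z, ((scanOp K)^[k] f) z ∂μ = ∫ z, f z ∂μ := by
  induction k with
  | zero => rfl
  | succ k ih =>
      rw [Function.iterate_succ_apply', integral_scanOp hinv (measurable_iterate_scanOp hf k)
        (abs_iterate_scanOp_le hfM k)]
      exact ih

/-- Dobrushin contraction: under locality and the row-sum condition `∑ j, c i j ≤ D`, the total oscillation of `(scanOp K)^[k] f` decays like `((n + D) / (n + 1))^k`. -/
theorem Phi_iterate_scanOp_le
    (hloc : ∀ i (z : Fin (n + 1) → E) (y : E), K i (update z i y) = K i z)
    {c : Fin (n + 1) → Fin (n + 1) → ℝ} (hc0 : ∀ i j, 0 ≤ c i j)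
    (hTV : ∀ i j (z : Fin (n + 1) → E) (y : E) (A : Set E), MeasurableSet A →
      ((K i z) A).toReal ≤ ((K i (update z j y)) A).toReal + c i j)
    {D : ℝ} (hrow : ∀ i, ∑ j, c i j ≤ D)
    {f : (Fin (n + 1) → E) → ℝ} (hf : Measurable f) {M : ℝ} (hfM : ∀ z, |f z| ≤ M) (k : ℕ) :
    Phi ((scanOp K)^[k] f) ≤ (((n : ℝ) + D) / ((n : ℝ) + 1)) ^ k * Phi f := by
  induction k with
  | zero => simp
  | succ k ih =>
      have hD0 : 0 ≤ D := (Finset.sum_nonneg fun j _ => hc0 0 j).trans (hrow 0)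
      have hr0 : 0 ≤ ((n : ℝ) + D) / ((n : ℝ) + 1) := by positivity
      rw [Function.iterate_succ_apply', pow_succ]
      calc Phi (scanOp K ((scanOp K)^[k] f))
          ≤ ((n : ℝ) + D) / ((n : ℝ) + 1) * Phi ((scanOp K)^[k] f) :=
            Phi_scanOp_le hloc hc0 hTV hrow (measurable_iterate_scanOp hf k)
              (abs_iterate_scanOp_le hfM k)
        _ ≤ ((n : ℝ) + D) / ((n : ℝ) + 1) * ((((n : ℝ) + D) / ((n : ℝ) + 1)) ^ k * Phi f) :=
            mul_le_mul_of_nonneg_left ih hr0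
        _ = _ := by ring

/-- The product of two bounded measurable functions is integrable against `μ`. -/
theorem integrable_mul_of_bounded {u w : (Fin (n + 1) → E) → ℝ} (hu : Measurable u)
    (hw : Measurable w) {Mu Mw : ℝ} (huM : ∀ z, |u z| ≤ Mu) (hwM : ∀ z, |w z| ≤ Mw) :
    Integrable (fun z => u z * w z) μ :=
  integrable_of_bounded (hu.mul hw) (M := Mu * Mw) fun z => by
    rw [abs_mul]
    exact mul_le_mul (huM z) (hwM z) (abs_nonneg _) ((abs_nonneg _).trans (huM z))

/-- `siteOp` commutes with subtracting a constant (Markov kernels). -/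
theorem siteOp_sub_const {f : (Fin (n + 1) → E) → ℝ} (hf : Measurable f) {M : ℝ}
    (hfM : ∀ z, |f z| ≤ M) (m : ℝ) (i : Fin (n + 1)) (z : Fin (n + 1) → E) :
    siteOp K i (fun x => f x - m) z = siteOp K i f z - m := by
  unfold siteOp
  rw [integral_sub (integrable_site K hf hfM i z) (integrable_const m), integral_const,
    probReal_univ, one_smul]

/-- **[K♭] The bounded Dobrushin–Glauber Poincaré inequality**, fully proved:
under locality, invariance and Dobrushin's row-sum condition `Σ_j c_ij ≤ D < 1`, every bounded
measurable `f` satisfies `∫ (f − μf)² dμ ≤ (1 − D)⁻¹ Σ_i ∫ (f − P_i f)² dμ`. -/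
theorem variance_le_of_dobrushin_bounded
    (hloc : ∀ i (z : Fin (n + 1) → E) (y : E), K i (update z i y) = K i z)
    (hinv : ∀ i (F : (Fin (n + 1) → E) → ℝ≥0∞), Measurable F →
      ∫⁻ z, ∫⁻ y, F (update z i y) ∂(K i z) ∂μ = ∫⁻ z, F z ∂μ)
    {c : Fin (n + 1) → Fin (n + 1) → ℝ} (hc0 : ∀ i j, 0 ≤ c i j)
    (hTV : ∀ i j (z : Fin (n + 1) → E) (y : E) (A : Set E), MeasurableSet A →
      ((K i z) A).toReal ≤ ((K i (update z j y)) A).toReal + c i j)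
    {D : ℝ} (hrow : ∀ i, ∑ j, c i j ≤ D) (hD1 : D < 1)
    {f : (Fin (n + 1) → E) → ℝ} (hf : Measurable f) {M : ℝ} (hfM : ∀ z, |f z| ≤ M) :
    ∫ z, (f z - ∫ x, f x ∂μ) ^ 2 ∂μ ≤
      (1 - D)⁻¹ * ∑ i, ∫ z, (f z - siteOp K i f z) ^ 2 ∂μ := by
  set m : ℝ := ∫ x, f x ∂μ with hm
  set g : (Fin (n + 1) → E) → ℝ := fun z => f z - m with hg
  have hgm : Measurable g := hf.sub_const m
  have hmM : |m| ≤ M := by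
    have h := norm_integral_le_of_norm_le_const (μ := μ) (f := f) (C := M)
      (Filter.Eventually.of_forall fun x => (hfM x : ‖f x‖ ≤ M))
    rw [Real.norm_eq_abs, probReal_univ, mul_one] at h
    exact h
  have hgM : ∀ z, |g z| ≤ 2 * M := fun z => by
    rw [hg]; dsimp only
    calc |f z - m| ≤ |f z| + |m| := abs_sub _ _
      _ ≤ M + M := add_le_add (hfM z) hmM
      _ = 2 * M := by ring
  have hg0 : ∫ z, g z ∂μ = 0 := by
    rw [hg]; dsimp only
    rw [integral_sub (integrable_of_bounded hf hfM) (integrable_const m), integral_const,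
      probReal_univ, one_smul, hm, sub_self]
  set r : ℝ := ((n : ℝ) + D) / ((n : ℝ) + 1) with hr
  have hD0 : 0 ≤ D := (Finset.sum_nonneg fun j _ => hc0 0 j).trans (hrow 0)
  have hn1 : (0 : ℝ) < (n : ℝ) + 1 := by positivity
  have hr0 : 0 ≤ r := by positivity
  set T := scanOp K with hT
  have hmeas : ∀ k, Measurable (T^[k] g) := measurable_iterate_scanOp hgm
  have hbdd : ∀ k z, |(T^[k] g) z| ≤ 2 * M := abs_iterate_scanOp_le hgM
  have hint : ∀ k, ∫ z, (T^[k] g) z ∂μ = 0 := fun k => by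
    rw [hT, integral_iterate_scanOp hinv hgm hgM k, hg0]
  have hPhi : ∀ k, Phi (T^[k] g) ≤ r ^ k * Phi g := Phi_iterate_scanOp_le hloc hc0 hTV hrow hgm hgM
  -- the sequence v_k = ‖T^k g‖²
  set v : ℕ → ℝ := fun k => ∫ z, ((T^[k] g) z) ^ 2 ∂μ with hv
  have hv0 : ∀ k, 0 ≤ v k := fun k => integral_nonneg fun z => sq_nonneg _
  have hsqi : ∀ k, Integrable (fun z => ((T^[k] g) z) ^ 2) μ := fun k => by
    have := integrable_mul_of_bounded (μ := μ) (hmeas k) (hmeas k) (hbdd k) (hbdd k)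
    simpa [pow_two] using this
  -- (i) a-priori decay from Dobrushin's contraction
  have hdecay : ∀ k, v k ≤ Phi g ^ 2 * (r ^ 2) ^ k := by
    intro k
    have hpt : ∀ z, ((T^[k] g) z) ^ 2 ≤ (r ^ k * Phi g) ^ 2 := by
      intro z
      have h1 : |(T^[k] g) z| ≤ r ^ k * Phi g := by
        have h2 := abs_sub_integral_le_Phi (μ := μ) (hmeas k) (hbdd k) z
        rw [hint k, sub_zero] at h2
        exact h2.trans (hPhi k)
      exact sq_le_sq' (abs_le.1 h1).1 (abs_le.1 h1).2
    calc v k = ∫ z, ((T^[k] g) z) ^ 2 ∂μ := rfl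
      _ ≤ ∫ _, (r ^ k * Phi g) ^ 2 ∂μ :=
          integral_mono (hsqi k) (integrable_const _) hpt
      _ = Phi g ^ 2 * (r ^ 2) ^ k := by rw [integral_const, probReal_univ, one_smul]; ring
  -- (ii) log-convexity from self-adjointness
  have hsa : ∀ k, v (k + 1) = ∫ z, (T^[k] g) z * (T^[k + 2] g) z ∂μ := by
    intro k
    have e1 : T^[k + 1] g = T (T^[k] g) := Function.iterate_succ_apply' _ _ _
    have e2 : T^[k + 2] g = T (T^[k + 1] g) := Function.iterate_succ_apply' _ _ _
    show ∫ z, ((T^[k + 1] g) z) ^ 2 ∂μ = _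
    rw [e2, hT, integral_mul_scanOp_comm hloc hinv (hmeas k) (hmeas (k + 1)) (hbdd k)
      (hbdd (k + 1)), ← hT, ← e1]
    simp_rw [pow_two]
  have hlc : ∀ k, v (k + 1) ^ 2 ≤ v k * v (k + 2) := by
    intro k
    refine sq_le_mul_of_forall (hv0 _) (hv0 _) (hv0 _) fun t ht => ?_
    rw [hsa k]
    have hab : Integrable (fun z => (T^[k] g) z * (T^[k + 2] g) z) μ :=
      integrable_mul_of_bounded (hmeas k) (hmeas (k + 2)) (hbdd k) (hbdd (k + 2))
    calc 2 * ∫ z, (T^[k] g) z * (T^[k + 2] g) z ∂μ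
        = ∫ z, 2 * ((T^[k] g) z * (T^[k + 2] g) z) ∂μ := (integral_const_mul _ _).symm
      _ ≤ ∫ z, (t * ((T^[k] g) z) ^ 2 + t⁻¹ * ((T^[k + 2] g) z) ^ 2) ∂μ :=
          integral_mono (hab.const_mul 2) (((hsqi k).const_mul t).add ((hsqi (k + 2)).const_mul t⁻¹))
            fun z => two_mul_le_of_sq ht
      _ = t * v k + t⁻¹ * v (k + 2) := by
          rw [integral_add ((hsqi k).const_mul t) ((hsqi (k + 2)).const_mul t⁻¹),
            integral_const_mul, integral_const_mul]
  -- (iii) hence ‖T g‖² ≤ r² ‖g‖²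
  have hratio : v 1 ≤ r ^ 2 * v 0 := ratio_le_of_logConvex hv0 hlc (sq_nonneg r) hdecay
  -- (iv) ⟨g, T g⟩ ≤ r ‖g‖²
  have hgi : Integrable (fun z => g z * T g z) μ :=
    integrable_mul_of_bounded hgm (measurable_scanOp K hgm) hgM (abs_scanOp_le K hgM)
  have hx0 : 0 ≤ ∫ z, g z * T g z ∂μ := by
    rw [hT, integral_mul_scanOp_self hloc hinv hgm hgM]
    exact mul_nonneg (inv_nonneg.2 hn1.le)
      (Finset.sum_nonneg fun i _ => integral_nonneg fun z => sq_nonneg _)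
  have hCS : (∫ z, g z * T g z ∂μ) ^ 2 ≤ v 0 * v 1 := by
    refine sq_le_mul_of_forall hx0 (hv0 0) (hv0 1) fun t ht => ?_
    have hv0e : v 0 = ∫ z, (g z) ^ 2 ∂μ := rfl
    have hv1e : v 1 = ∫ z, (T g z) ^ 2 ∂μ := rfl
    have hsq0 : Integrable (fun z => (g z) ^ 2) μ := hsqi 0
    have hsq1 : Integrable (fun z => (T g z) ^ 2) μ := hsqi 1
    calc 2 * ∫ z, g z * T g z ∂μ = ∫ z, 2 * (g z * T g z) ∂μ := (integral_const_mul _ _).symm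
      _ ≤ ∫ z, (t * (g z) ^ 2 + t⁻¹ * (T g z) ^ 2) ∂μ :=
          integral_mono (hgi.const_mul 2) ((hsq0.const_mul t).add (hsq1.const_mul t⁻¹))
            fun z => two_mul_le_of_sq ht
      _ = t * v 0 + t⁻¹ * v 1 := by
          rw [integral_add (hsq0.const_mul t) (hsq1.const_mul t⁻¹), integral_const_mul,
            integral_const_mul]
          rfl
  have hgT : ∫ z, g z * T g z ∂μ ≤ r * v 0 := by
    have h1 : (∫ z, g z * T g z ∂μ) ^ 2 ≤ (r * v 0) ^ 2 :=
      hCS.trans (by nlinarith [hratio, hv0 0])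
    exact (pow_le_pow_iff_left₀ hx0 (mul_nonneg hr0 (hv0 0)) two_ne_zero).1 h1
  -- (v) the algebra: Σ_i ‖g − P_i g‖² = (n+1)‖g‖² − Σ_i ‖P_i g‖² ≥ (1 − D)‖g‖²
  have hS : ∑ i, ∫ z, (siteOp K i g z) ^ 2 ∂μ ≤ ((n : ℝ) + D) * v 0 := by
    have h1 := hgT
    rw [hT, integral_mul_scanOp_self hloc hinv hgm hgM] at h1
    rw [hr] at h1
    have h2 := mul_le_mul_of_nonneg_left h1 hn1.le
    rw [← mul_assoc, mul_inv_cancel₀ hn1.ne', one_mul] at h2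
    calc ∑ i, ∫ z, (siteOp K i g z) ^ 2 ∂μ ≤ ((n : ℝ) + 1) * (((n : ℝ) + D) / ((n : ℝ) + 1) * v 0) := h2
      _ = ((n : ℝ) + D) * v 0 := by field_simp
  have hexp : ∀ i, ∫ z, (g z - siteOp K i g z) ^ 2 ∂μ = v 0 - ∫ z, (siteOp K i g z) ^ 2 ∂μ := by
    intro i
    have hPi : Measurable (siteOp K i g) := measurable_siteOp K hgm i
    have hPiM : ∀ z, |siteOp K i g z| ≤ 2 * M := abs_siteOp_le K hgM i
    have i1 : Integrable (fun z => (g z) ^ 2) μ := hsqi 0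
    have i2 : Integrable (fun z => g z * siteOp K i g z) μ :=
      integrable_mul_of_bounded hgm hPi hgM hPiM
    have i3 : Integrable (fun z => (siteOp K i g z) ^ 2) μ := by
      have := integrable_mul_of_bounded (μ := μ) hPi hPi hPiM hPiM
      simpa [pow_two] using this
    have hcross : ∫ z, g z * siteOp K i g z ∂μ = ∫ z, (siteOp K i g z) ^ 2 ∂μ := by
      rw [integral_mul_siteOp hloc hinv hgm hgm hgM hgM i]
      simp_rw [pow_two]
    have hpt : ∀ z, (g z - siteOp K i g z) ^ 2 =
        (g z) ^ 2 - 2 * (g z * siteOp K i g z) + (siteOp K i g z) ^ 2 := fun z => by ring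
    simp_rw [hpt]
    have i12 : Integrable (fun z => (g z) ^ 2 - 2 * (g z * siteOp K i g z)) μ :=
      i1.sub (i2.const_mul 2)
    rw [integral_add i12 i3, integral_sub i1 (i2.const_mul 2),
      integral_const_mul, hcross]
    show (v 0 - 2 * ∫ z, (siteOp K i g z) ^ 2 ∂μ) + ∫ z, (siteOp K i g z) ^ 2 ∂μ = _
    ring
  have hsum : (1 - D) * v 0 ≤ ∑ i, ∫ z, (g z - siteOp K i g z) ^ 2 ∂μ := by
    simp_rw [hexp]
    rw [Finset.sum_sub_distrib, Finset.sum_const, Finset.card_univ, Fintype.card_fin,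
      nsmul_eq_mul]
    push_cast
    linarith [hS]
  -- (vi) back to `f`
  have hgf : ∀ i z, g z - siteOp K i g z = f z - siteOp K i f z := by
    intro i z
    rw [hg]; dsimp only
    rw [siteOp_sub_const hf hfM m i z]
    ring
  simp_rw [hgf] at hsum
  have h1D : 0 < 1 - D := by linarith
  calc ∫ z, (f z - m) ^ 2 ∂μ = v 0 := rfl
    _ = (1 - D)⁻¹ * ((1 - D) * v 0) := by field_simp
    _ ≤ (1 - D)⁻¹ * ∑ i, ∫ z, (f z - siteOp K i f z) ^ 2 ∂μ :=
        mul_le_mul_of_nonneg_left hsum (inv_nonneg.2 h1D.le)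

end Spectral

end Summit.AtomisticToContinuum.HydrodynamicLimit.Theorems.HardCorePoincareDobrushin.Abstract

end
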